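import Summits.BirchSwinnertonDyer.BirchSwinnertonDyer.Theorems.SignedLowerHalvesSmallImageLowerHalfBothSignsRttD2SeqJ3RShapiroBridge
import Literature.NumberTheory.GaloisRepresentations.ContinuousShapiroLiftMackeyCup
import Literature.NumberTheory.GaloisRepresentations.ContinuousShapiroLiftMackeyH1
import Literature.NumberTheory.EllipticCurves.SubgroupSelmer
import HarnessLib

/-!
# Route `SignedLowerHalves`, crux L `SmallImageLowerHalfBothSigns` (stmt-BirchSwinnertonDyer-23599), line `rtt_w3` v15 — E2, row J3 residual
# (`RSeq`), brick R2: THE LOCAL TERM AT A FINITE PLACE `w` OF THE GLOBAL SHAPIRO CUP CLASS `Sh_U a ∪_{ΣP} Sh_U b ∈ H²(Γ_K, μₙ)`, READ IN THE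
# CORESTRICTION MODEL: `inv_w(loc_w(Sh a ∪ Sh b)) = Σ_i ⟨loc_w(g_i · a), loc_w(g_i · b)⟩_{U_w}` (all orbits) and `= ⟨loc_w a, loc_w b⟩_{U_w}` (one orbit)

WIDTH seat `bsd-line-slh-p3-w3` g23 under LEAD `cruxlead-stmt-BirchSwinnertonDyer-23599` g11 (cell `bsd-ssimc`); helper `--supports stmt-BirchSwinnertonDyer-23599`.
THEOREMS ONLY; no definition, no named fact, no instance, no `sorry`. HONEST FRAMING: the number-field `K`-version of the tree's `ℚ`-cyclotomic
`CyclotomicLayer.invAt_localization_cupProduct_shapiroLift_eq_sum/_eq_of_surjective` (Mackey's double-coset formula for cup products of Shapiro lifts,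
`ContPairing.map_cupProduct_coindFin_shapiroLift_sum`), with the local layer pairings written as the tree's `localPairingSubgroup` (the currency of
`SmallImageRttD2Seq.pairLoc`, p786363) through the bridge R1 (`localPairingSubgroup_eq_localInvariantMap_cupProduct_shapiroLift`, p793621). Nothing about any
curve; E2, crux L, crux M, BSD remain OPEN and are proved for NO curve.

Setting: `K` a number field, `n ≥ 1`, discrete `Γ_K`-modules `X, Y` (`ContinuousRep … ℤ`), a continuous equivariant pairing `P : X × Y → μₙ(K̄)` (`mu K n`), an open normal
subgroup `U ⊴ Γ_K` of finite index (a layer `Gal(K̄/K_n)`), a finite place `w`, `θ_w = resGalOfEmb (closureEmb K_w) : Γ_{K_w} → Γ_K`, `U_w = θ_w⁻¹U = localSubgroupOfEmb U (closureEmb K_w)`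
(the decomposition group of the place of `K̄^U` above `w` singled out by the embedding), `θ_{U,w}^* : H¹(U, ·) → H¹(U_w, ·)` the restriction (`comapSubtypeHom`, `comapCoeffHom`),
`g · a = conjMap … g 1 a` the conjugation action of `Γ_K` on `H¹(U, ·)` (the other places above `w`).

* `localPairingSubgroup_restrict_congr` (bookkeeping: the local pairing for `P|_{θ_w}`).
* ★★ `localInvariantMap_map_cupProduct_shapiroLift_eq_sum` — ALL ORBITS: for orbit representatives `g : ι → Γ_K` of the `Γ_{K_w}`-action on `Γ_K ⧸ U`,
  `inv_w(θ_w^*(Sh_U a ∪_{ΣP} Sh_U b)) = Σ_i localPairingSubgroup K n w X|_{θ_w} Y|_{θ_w} P|_{θ_w} U_w (θ_{U,w}^*(g_i · a)) (θ_{U,w}^*(g_i · b))`.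
* ★★ `localInvariantMap_map_cupProduct_shapiroLift_eq_of_surjective` — ONE ORBIT (`θ_w(Γ_{K_w})·U = Γ_K`: `w` does not split in `K̄^U`):
  `inv_w(θ_w^*(Sh_U a ∪_{ΣP} Sh_U b)) = localPairingSubgroup … U_w (θ_{U,w}^* a) (θ_{U,w}^* b)`.
* `localInvariantMap_map_cupProduct_shapiroLift_eq_zero_of_forall_conj` — VANISHING: if `⟨θ_{U,w}^*(g · a), θ_{U,w}^*(g · b)⟩_{U_w} = 0` for every `g ∈ Γ_K`
  (every place of `K̄^U` above `w`), the local term at `w` vanishes.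
References: [Brown1982] III §5 (5.6)(b); [NeukirchSchmidtWingberg2008] I §5 (1.5.3), (1.5.6)–(1.5.7), I §6 (1.6.4); [Kobayashi2003] (8.23); [MilneADT2006] I §6 (proof of Prop. 6.9).
-/

set_option autoImplicit false
set_option linter.dupNamespace false -- D-0017: single-problem summit, the namespace repeats the problem name by design
noncomputable section

open scoped Classical
open CategoryTheory Function NumberField IsDedekindDomain Field

namespace Summit.BirchSwinnertonDyer.BirchSwinnertonDyer.Theorems.SmallImageRttD2Seq

open Literature.NumberTheory.GaloisRepresentations Literature.NumberTheory.GaloisCohomology Literature.NumberTheory.EllipticCurves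
open Literature.NumberTheory.GaloisRepresentations.DiscreteGaloisModule (mu MuCarrier)

universe w'

variable (K : Type) [Field K] [NumberField K] (n : ℕ) [NeZero n]
  {MX MY : Type} [AddCommGroup MX] [TopologicalSpace MX] [DiscreteTopology MX] [AddCommGroup MY] [TopologicalSpace MY] [DiscreteTopology MY]
  (ρX : ContinuousRep (absoluteGaloisGroup K) ℤ MX) (ρY : ContinuousRep (absoluteGaloisGroup K) ℤ MY)
  (P : ContPairing ρX.toTopRep ρY.toTopRep (mu K n).toTopRep)
  (U : Subgroup (absoluteGaloisGroup K)) [hUn : U.Normal] (hU : IsOpen (U : Set (absoluteGaloisGroup K))) [Fintype (absoluteGaloisGroup K ⧸ U)]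
  {s : absoluteGaloisGroup K ⧸ U → absoluteGaloisGroup K} (hs : ∀ y, (s y : absoluteGaloisGroup K ⧸ U) = y)
  (hs1 : s ((1 : absoluteGaloisGroup K) : absoluteGaloisGroup K ⧸ U) = 1)
  (w : HeightOneSpectrum (𝓞 K))
  [hcl : IsClosed (localSubgroupOfEmb U (closureEmb (K := K) (w.adicCompletion K)) : Set (absoluteGaloisGroup (w.adicCompletion K)))]
  [hfq : Fintype (absoluteGaloisGroup (w.adicCompletion K) ⧸ localSubgroupOfEmb U (closureEmb (K := K) (w.adicCompletion K)))]

/-- The pairing `P` restricted along `θ_w : Γ_{K_w} → Γ_K`, typed on the restricted `ContinuousRep`s and on `muAt K n w = μₙ(K̄)|_{Γ_{K_w}}` (the currency of the tree's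
`localPairingSubgroup`; the same bilinear map). [cite: MilneADT2006, Ch. I §2] -/
abbrev resPairingAt :
    ContPairing (ρX.restrict (resGalOfEmb (closureEmb (K := K) (w.adicCompletion K)))).toTopRep
      (ρY.restrict (resGalOfEmb (closureEmb (K := K) (w.adicCompletion K)))).toTopRep (muAt K n w).toTopRep :=
  P.restrict (resGalOfEmb (closureEmb (K := K) (w.adicCompletion K)))

/-- ★★ **The local term at `w`, ALL ORBITS, in the corestriction model.** For orbit representatives `g : ι → Γ_K` of the `Γ_{K_w}`-action on `Γ_K ⧸ U`
(`(i, y') ↦ ē(y')·g_i U` a bijection `ι × (Γ_{K_w} ⧸ U_w) ≃ Γ_K ⧸ U`; `#ι` = number of places of `K̄^U` above `w`) and `a ∈ H¹(U, X)`, `b ∈ H¹(U, Y)`: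
`inv_w(θ_w^*(Sh_U a ∪_{ΣP} Sh_U b)) = Σ_i ⟨θ_{U,w}^*(g_i · a), θ_{U,w}^*(g_i · b)⟩_{U_w}` with `⟨·,·⟩_{U_w}` the tree's `localPairingSubgroup` (`inv_w ∘ cor_{Γ_{K_w}/U_w}` of the
cup product). Proof: Mackey for cup products of Shapiro lifts (tree `ContPairing.map_cupProduct_coindFin_shapiroLift_sum`) read through the bridge R1.
[cite: Brown1982, III §5 (5.6)(b)] [cite: NeukirchSchmidtWingberg2008, I §5 (1.5.6)–(1.5.7) and I §6 Prop. (1.6.4)] [cite: Kobayashi2003, (8.23) (p. 18)] -/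
theorem localInvariantMap_map_cupProduct_shapiroLift_eq_sum [CompactSpace (absoluteGaloisGroup K)]
    [CompactSpace (absoluteGaloisGroup (w.adicCompletion K))]
    {ι : Type} [Fintype ι] (g : ι → absoluteGaloisGroup K)
    (hbij : Function.Bijective fun q : ι × (absoluteGaloisGroup (w.adicCompletion K) ⧸ localSubgroupOfEmb U (closureEmb (K := K) (w.adicCompletion K))) =>
      quotientMapOfHom U (resGalOfEmb (closureEmb (K := K) (w.adicCompletion K))) q.2 * (g q.1 : absoluteGaloisGroup K ⧸ U))
    (a : continuousCohomology 1 (subgroupRep ρX.toTopRep U)) (b : continuousCohomology 1 (subgroupRep ρY.toTopRep U)) :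
    localInvariantMap K n w
        (ContinuousCohomology.map (resGalOfEmb (closureEmb (K := K) (w.adicCompletion K)))
          (𝟙 (TopRep.res (resGalOfEmb (closureEmb (K := K) (w.adicCompletion K)) : absoluteGaloisGroup (w.adicCompletion K) →* absoluteGaloisGroup K)
            (mu K n).toTopRep)) 2
          ((P.coindFin U).cupProduct (shapiroLift ρX.toTopRep U hU hs hs1 a) (shapiroLift ρY.toTopRep U hU hs hs1 b))) =
      ∑ i, localPairingSubgroup K n w (ρX.restrict (resGalOfEmb (closureEmb (K := K) (w.adicCompletion K))))
        (ρY.restrict (resGalOfEmb (closureEmb (K := K) (w.adicCompletion K)))) (resPairingAt K n ρX ρY P w)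
        (localSubgroupOfEmb U (closureEmb (K := K) (w.adicCompletion K)))
        (ContinuousCohomology.map (comapSubtypeHom U (resGalOfEmb (closureEmb (K := K) (w.adicCompletion K))))
          (comapCoeffHom ρX.toTopRep U (resGalOfEmb (closureEmb (K := K) (w.adicCompletion K)))) 1 (conjMap ρX.toTopRep U (g i) 1 a))
        (ContinuousCohomology.map (comapSubtypeHom U (resGalOfEmb (closureEmb (K := K) (w.adicCompletion K))))
          (comapCoeffHom ρY.toTopRep U (resGalOfEmb (closureEmb (K := K) (w.adicCompletion K)))) 1 (conjMap ρY.toTopRep U (g i) 1 b)) := by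
  -- representatives of `Γ_{K_w} ⧸ U_w` with `sD 1 = 1` (the values on classes do not depend on them)
  obtain ⟨sD, hsD, hsD1⟩ := exists_reps_one (localSubgroupOfEmb U (closureEmb (K := K) (w.adicCompletion K)))
  have hopen : IsOpen (localSubgroupOfEmb U (closureEmb (K := K) (w.adicCompletion K)) : Set (absoluteGaloisGroup (w.adicCompletion K))) :=
    isOpen_comap U (resGalOfEmb (closureEmb (K := K) (w.adicCompletion K))) hU
  letI hfq' : Fintype (absoluteGaloisGroup (w.adicCompletion K) ⧸ U.comap ((resGalOfEmb (closureEmb (K := K) (w.adicCompletion K)) : absoluteGaloisGroup (w.adicCompletion K) →* absoluteGaloisGroup K))) := hfq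
  have hM := ContPairing.map_cupProduct_coindFin_shapiroLift_sum P U (resGalOfEmb (closureEmb (K := K) (w.adicCompletion K))) hU g hbij hs hs1
    hsD hsD1 a b
  rw [hM]
  refine (map_sum (localInvariantMap K n w) _ Finset.univ).trans (Finset.sum_congr rfl fun i _ => ?_)
  exact (localPairingSubgroup_eq_localInvariantMap_cupProduct_shapiroLift K n w
    (ρX.restrict (resGalOfEmb (closureEmb (K := K) (w.adicCompletion K)))) (ρY.restrict (resGalOfEmb (closureEmb (K := K) (w.adicCompletion K))))
    (resPairingAt K n ρX ρY P w) (localSubgroupOfEmb U (closureEmb (K := K) (w.adicCompletion K))) hopen hsD hsD1 _ _).symm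

/-- ★★ **The local term at `w`, ONE ORBIT** (`θ_w(Γ_{K_w})·U = Γ_K`, i.e. `ē : Γ_{K_w} ⧸ U_w → Γ_K ⧸ U` onto: the place `w` has a single place of `K̄^U` above it —
inert/non-split or totally ramified): `inv_w(θ_w^*(Sh_U a ∪_{ΣP} Sh_U b)) = ⟨θ_{U,w}^* a, θ_{U,w}^* b⟩_{U_w}`.
[cite: NeukirchSchmidtWingberg2008, I §6 Prop. (1.6.4), (1.6.5)] [cite: Kobayashi2003, (8.23) (p. 18)] -/
theorem localInvariantMap_map_cupProduct_shapiroLift_eq_of_surjective [CompactSpace (absoluteGaloisGroup K)]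
    [CompactSpace (absoluteGaloisGroup (w.adicCompletion K))]
    (hsurj : Function.Surjective (quotientMapOfHom U (resGalOfEmb (closureEmb (K := K) (w.adicCompletion K)))))
    (a : continuousCohomology 1 (subgroupRep ρX.toTopRep U)) (b : continuousCohomology 1 (subgroupRep ρY.toTopRep U)) :
    localInvariantMap K n w
        (ContinuousCohomology.map (resGalOfEmb (closureEmb (K := K) (w.adicCompletion K)))
          (𝟙 (TopRep.res (resGalOfEmb (closureEmb (K := K) (w.adicCompletion K)) : absoluteGaloisGroup (w.adicCompletion K) →* absoluteGaloisGroup K)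
            (mu K n).toTopRep)) 2
          ((P.coindFin U).cupProduct (shapiroLift ρX.toTopRep U hU hs hs1 a) (shapiroLift ρY.toTopRep U hU hs hs1 b))) =
      localPairingSubgroup K n w (ρX.restrict (resGalOfEmb (closureEmb (K := K) (w.adicCompletion K))))
        (ρY.restrict (resGalOfEmb (closureEmb (K := K) (w.adicCompletion K)))) (resPairingAt K n ρX ρY P w)
        (localSubgroupOfEmb U (closureEmb (K := K) (w.adicCompletion K)))
        (ContinuousCohomology.map (comapSubtypeHom U (resGalOfEmb (closureEmb (K := K) (w.adicCompletion K))))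
          (comapCoeffHom ρX.toTopRep U (resGalOfEmb (closureEmb (K := K) (w.adicCompletion K)))) 1 a)
        (ContinuousCohomology.map (comapSubtypeHom U (resGalOfEmb (closureEmb (K := K) (w.adicCompletion K))))
          (comapCoeffHom ρY.toTopRep U (resGalOfEmb (closureEmb (K := K) (w.adicCompletion K)))) 1 b) := by
  have hbij : Function.Bijective fun q : Unit × (absoluteGaloisGroup (w.adicCompletion K) ⧸ localSubgroupOfEmb U (closureEmb (K := K) (w.adicCompletion K))) =>
      quotientMapOfHom U (resGalOfEmb (closureEmb (K := K) (w.adicCompletion K))) q.2 *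
        (((fun _ : Unit => (1 : absoluteGaloisGroup K)) q.1 : absoluteGaloisGroup K) : absoluteGaloisGroup K ⧸ U) := by
    have hinj := quotientMapOfHom_injective U (resGalOfEmb (closureEmb (K := K) (w.adicCompletion K)))
    constructor
    · rintro ⟨u₁, y₁⟩ ⟨u₂, y₂⟩ h
      simp only [QuotientGroup.mk_one, mul_one] at h
      exact Prod.ext (Subsingleton.elim _ _) (hinj h)
    · intro y
      obtain ⟨y', hy'⟩ := hsurj y
      exact ⟨((), y'), by simp only [QuotientGroup.mk_one, mul_one]; exact hy'⟩
  rw [localInvariantMap_map_cupProduct_shapiroLift_eq_sum K n ρX ρY P U hU hs hs1 w (fun _ : Unit => 1) hbij a b, Fintype.sum_unique,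
    conjMap_one_one, conjMap_one_one]

/-- ★ **Vanishing of the local term at `w`**: if `⟨θ_{U,w}^*(g · a), θ_{U,w}^*(g · b)⟩_{U_w} = 0` for EVERY `g ∈ Γ_K` (i.e. the layer pairing vanishes at every place of `K̄^U`
above `w`), then `inv_w(θ_w^*(Sh_U a ∪_{ΣP} Sh_U b)) = 0` (orbit representatives exist: tree `exists_orbitReps_bijective`).
[cite: Brown1982, III §5 (5.6)(b)] [cite: NeukirchSchmidtWingberg2008, I §5 (1.5.6)–(1.5.7)] -/
theorem localInvariantMap_map_cupProduct_shapiroLift_eq_zero_of_forall_conj [CompactSpace (absoluteGaloisGroup K)]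
    [CompactSpace (absoluteGaloisGroup (w.adicCompletion K))]
    (a : continuousCohomology 1 (subgroupRep ρX.toTopRep U)) (b : continuousCohomology 1 (subgroupRep ρY.toTopRep U))
    (h : ∀ g : absoluteGaloisGroup K,
      localPairingSubgroup K n w (ρX.restrict (resGalOfEmb (closureEmb (K := K) (w.adicCompletion K))))
        (ρY.restrict (resGalOfEmb (closureEmb (K := K) (w.adicCompletion K)))) (resPairingAt K n ρX ρY P w)
        (localSubgroupOfEmb U (closureEmb (K := K) (w.adicCompletion K)))
        (ContinuousCohomology.map (comapSubtypeHom U (resGalOfEmb (closureEmb (K := K) (w.adicCompletion K))))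
          (comapCoeffHom ρX.toTopRep U (resGalOfEmb (closureEmb (K := K) (w.adicCompletion K)))) 1 (conjMap ρX.toTopRep U g 1 a))
        (ContinuousCohomology.map (comapSubtypeHom U (resGalOfEmb (closureEmb (K := K) (w.adicCompletion K))))
          (comapCoeffHom ρY.toTopRep U (resGalOfEmb (closureEmb (K := K) (w.adicCompletion K)))) 1 (conjMap ρY.toTopRep U g 1 b)) = 0) :
    localInvariantMap K n w
        (ContinuousCohomology.map (resGalOfEmb (closureEmb (K := K) (w.adicCompletion K)))
          (𝟙 (TopRep.res (resGalOfEmb (closureEmb (K := K) (w.adicCompletion K)) : absoluteGaloisGroup (w.adicCompletion K) →* absoluteGaloisGroup K)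
            (mu K n).toTopRep)) 2
          ((P.coindFin U).cupProduct (shapiroLift ρX.toTopRep U hU hs hs1 a) (shapiroLift ρY.toTopRep U hU hs hs1 b))) = 0 := by
  haveI : U.FiniteIndex := Subgroup.finiteIndex_of_finite_quotient
  obtain ⟨ι, _, g, hbij⟩ := exists_orbitReps_bijective U (resGalOfEmb (closureEmb (K := K) (w.adicCompletion K)))
  rw [localInvariantMap_map_cupProduct_shapiroLift_eq_sum K n ρX ρY P U hU hs hs1 w g hbij a b]
  exact Finset.sum_eq_zero fun i _ => h (g i)

end Summit.BirchSwinnertonDyer.BirchSwinnertonDyer.Theorems.SmallImageRttD2Seq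

end
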